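import Summits.CriticalPhenomena.Ising3DConformalLimit.Theorems.HyperoctahedralRPLimitRotationInvariantQuarterTurnDefs
import Summits.CriticalPhenomena.Ising3DConformalLimit.Theorems.HyperoctahedralRPLimitRotationInvariantInPlaneLightCone
import Summits.CriticalPhenomena.Ising3DConformalLimit.Theorems.HyperoctahedralRPLimitRotationInvariantBoostEntireOfType
import Literature.MathematicalPhysics.QuantumFieldTheory.MirrorClusterOSSpace
import Literature.MathematicalPhysics.QuantumFieldTheory.PointwiseOSReconstruction
import HarnessLib

/-!
# Stub `stub_axisSigmaBound_of_unit` (S3'a) of the line `quarter-turn-liouville`,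
crux `HyperoctahedralRP.LimitRotationInvariant` (stmt-CriticalPhenomena-1980)

The reduction of the frame-`e₀` two-sided sigma bound to its dimensionless instance: if the one-spin
sandwich between a bra cluster combination pushed to height `≥ 1` and a ket combination pushed to
height `≥ 1` is bounded by `C₁` times the two Osterwalder–Schrader norms, then the sandwich with
heights `u, v > 0` is bounded by `|C₁| (u^{-Δ} + v^{-Δ})` times the norms.

Proof (Osterwalder–Schrader 1973 §4.1; Glimm–Jaffe, *Quantum Physics* (1987), Thm. 6.1.3).
* SHIFT: with `w = min u v`, the `(u, v)` configuration on the clusters `A, B` is literally the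
  `(w, w)` configuration on the shifted clusters `A + (u - w) e₀`, `B + (v - w) e₀`.
* SCALE (`sandwich_scale`, `osNorm_scale`, `scale_step`): scale covariance `IsScaleCovariant Δ S` with
  the factor `w`, applied to the unit inequality at the dilated data (clusters `w⁻¹ A`, `w⁻¹ B`, point
  `w⁻¹ y`, coefficients `c_a w^{-k_a Δ}`, `d_b w^{-k'_b Δ}`): the `(w, w)` sandwich is `w^{-Δ}` times a
  unit sandwich, and the two OS norms are invariant.
* CONTRACTION (`osNorm_shift_le`): the OS norm of a cluster combination shifted up by `t e₀`, `t ≥ 0`,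
  is at most the unshifted one — `‖e^{-tH} ψ‖ ≤ ‖ψ‖` for the transfer semigroup of the frame `e₀`
  (tree: `MirrorOSData.transfer`, an energy–momentum pair, on the kernel-level OS space of the mirror
  `e₀^⊥`, whose data `MirrorOSData S e₀` a limit structure carries by `mirrorOSData_latticeNormal`).
* `w^{-Δ} ≤ u^{-Δ} + v^{-Δ}` and the OS norms are non-negative (reflection positivity in `e₀^⊥`).
-/

noncomputable section

open scoped BigOperators InnerProductSpace
open ComplexConjugate
open Literature.Probability.LatticeModels
open Literature.MathematicalPhysics.QuantumFieldTheory
open Literature.Analysis.OperatorTheory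

namespace Summit.CriticalPhenomena.Ising3DConformalLimit.Cruxes.LimitRotationInvariant.QuarterTurnLiouville

/-! ## Scale covariance: the `(w, w)` sandwich is `w^{-Δ}` times a unit sandwich -/

/-- Splitting the scaling exponent of a three-block configuration. -/
theorem rpow_neg_add_one_add_mul {w : ℝ} (hw : 0 < w) (Δ : ℝ) (p q : ℕ) :
    w ^ (-((p + 1 + q : ℕ) : ℝ) * Δ) = w ^ (-(p : ℝ) * Δ) * w ^ (-Δ) * w ^ (-(q : ℝ) * Δ) := by
  rw [← Real.rpow_add hw, ← Real.rpow_add hw]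
  congr 1
  push_cast
  ring

/-- Splitting the scaling exponent of a two-block configuration. -/
theorem rpow_neg_add_mul {w : ℝ} (hw : 0 < w) (Δ : ℝ) (p q : ℕ) :
    w ^ (-((p + q : ℕ) : ℝ) * Δ) = w ^ (-(p : ℝ) * Δ) * w ^ (-(q : ℝ) * Δ) := by
  rw [← Real.rpow_add hw]
  congr 1
  push_cast
  ring

/-- **SCALE, sandwich.** By scale covariance with the factor `w > 0`, the `(w, w)` sandwich sum on
clusters `A, B` with the spin at `y` equals `w^{-Δ}` times the unit sandwich sum on the dilated
clusters `w⁻¹ A`, `w⁻¹ B` with the spin at `w⁻¹ y` and the coefficients `c_a w^{-k_a Δ}`,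
`d_b w^{-k'_b Δ}`. -/
theorem sandwich_scale {Δ : ℝ} {S : CorrFamily 3} (hsc : IsScaleCovariant Δ S) {w : ℝ} (hw : 0 < w)
    (y : EuclideanSpace ℝ (Fin 3)) (m : ℕ) (k : Fin m → ℕ)
    (A : (a : Fin m) → Fin (k a) → EuclideanSpace ℝ (Fin 3)) (c : Fin m → ℝ) (m' : ℕ) (k' : Fin m' → ℕ)
    (B : (b : Fin m') → Fin (k' b) → EuclideanSpace ℝ (Fin 3)) (d : Fin m' → ℝ) :
    (∑ a, ∑ b, c a * d b * S (k a + 1 + k' b)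
        (Fin.append (Fin.append (fun i => axisReflection 0 (A a i + w • EuclideanSpace.single 0 1)) ![y])
          (fun j => B b j + w • EuclideanSpace.single 0 1))) =
      w ^ (-Δ) * ∑ a, ∑ b, (c a * w ^ (-(k a : ℝ) * Δ)) * (d b * w ^ (-(k' b : ℝ) * Δ)) *
        S (k a + 1 + k' b)
          (Fin.append (Fin.append (fun i => axisReflection 0 (w⁻¹ • A a i + EuclideanSpace.single 0 1))
            ![w⁻¹ • y]) (fun j => w⁻¹ • B b j + EuclideanSpace.single 0 1)) := by
  rw [Finset.mul_sum]
  refine Finset.sum_congr rfl fun a _ => ?_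
  rw [Finset.mul_sum]
  refine Finset.sum_congr rfl fun b _ => ?_
  have hcfg : (Fin.append (Fin.append (fun i => axisReflection 0 (A a i + w • EuclideanSpace.single 0 1)) ![y])
      (fun j => B b j + w • EuclideanSpace.single 0 1)) =
      fun l => w • Fin.append (Fin.append (fun i => axisReflection 0 (w⁻¹ • A a i + EuclideanSpace.single 0 1))
        ![w⁻¹ • y]) (fun j => w⁻¹ • B b j + EuclideanSpace.single 0 1) l := by
    funext l
    refine Fin.addCases (fun l₁ => ?_) (fun j => ?_) l
    · simp only [Fin.append_left]
      refine Fin.addCases (fun i => ?_) (fun o => ?_) l₁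
      · simp only [Fin.append_left]
        rw [← LinearIsometryEquiv.map_smul, smul_add, smul_inv_smul₀ hw.ne']
      · simp only [Fin.append_right]
        have ho : o = 0 := Fin.fin_one_eq_zero o
        subst ho
        simp [smul_inv_smul₀ hw.ne']
    · simp only [Fin.append_right]
      rw [smul_add, smul_inv_smul₀ hw.ne']
  rw [hcfg, hsc (k a + 1 + k' b) w hw, rpow_neg_add_one_add_mul hw]
  ring

/-- **SCALE, OS norm.** The OS norm (squared) of a cluster combination is invariant under the
dilation `A ↦ w⁻¹ A` with the coefficients `c_a ↦ c_a w^{-k_a Δ}`. -/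
theorem osNorm_scale {Δ : ℝ} {S : CorrFamily 3} (hsc : IsScaleCovariant Δ S) {w : ℝ} (hw : 0 < w)
    (m : ℕ) (k : Fin m → ℕ) (A : (a : Fin m) → Fin (k a) → EuclideanSpace ℝ (Fin 3)) (c : Fin m → ℝ) :
    (∑ a, ∑ a', (c a * w ^ (-(k a : ℝ) * Δ)) * (c a' * w ^ (-(k a' : ℝ) * Δ)) *
        S (k a + k a') (Fin.append (fun i => axisReflection 0 (w⁻¹ • A a i)) (fun i => w⁻¹ • A a' i))) =
      ∑ a, ∑ a', c a * c a' * S (k a + k a') (Fin.append (fun i => axisReflection 0 (A a i)) (A a')) := by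
  refine Finset.sum_congr rfl fun a _ => Finset.sum_congr rfl fun a' _ => ?_
  have hcfg : Fin.append (fun i => axisReflection 0 (A a i)) (A a') =
      fun l => w • Fin.append (fun i => axisReflection 0 (w⁻¹ • A a i)) (fun i => w⁻¹ • A a' i) l := by
    funext l
    refine Fin.addCases (fun i => ?_) (fun i => ?_) l
    · simp only [Fin.append_left]
      rw [← LinearIsometryEquiv.map_smul, smul_inv_smul₀ hw.ne']
    · simp only [Fin.append_right]
      rw [smul_inv_smul₀ hw.ne']
  rw [hcfg, hsc (k a + k a') w hw, rpow_neg_add_mul hw]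
  ring

/-- **SCALE.** The unit sandwich bound implies the `(w, w)` sandwich bound with the constant
`w^{-Δ} C₁`, for every `w > 0`. -/
theorem scale_step {Δ : ℝ} {S : CorrFamily 3} (hsc : IsScaleCovariant Δ S) {C₁ : ℝ}
    (hunit : ∀ y : EuclideanSpace ℝ (Fin 3), y 0 = 0 →
      ∀ (m : ℕ) (k : Fin m → ℕ) (A : (a : Fin m) → Fin (k a) → EuclideanSpace ℝ (Fin 3)) (c : Fin m → ℝ)
        (m' : ℕ) (k' : Fin m' → ℕ) (B : (b : Fin m') → Fin (k' b) → EuclideanSpace ℝ (Fin 3))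
        (d : Fin m' → ℝ),
        (∀ a i, 0 < A a i 0) → (∀ b j, 0 < B b j 0) →
        (∑ a, ∑ b, c a * d b * S (k a + 1 + k' b)
            (Fin.append (Fin.append (fun i => axisReflection 0 (A a i + EuclideanSpace.single 0 1)) ![y])
              (fun j => B b j + EuclideanSpace.single 0 1))) ^ 2
          ≤ C₁ ^ 2 *
            (∑ a, ∑ a', c a * c a' * S (k a + k a')
              (Fin.append (fun i => axisReflection 0 (A a i)) (A a'))) *
            (∑ b, ∑ b', d b * d b' * S (k' b + k' b')
              (Fin.append (fun j => axisReflection 0 (B b j)) (B b'))))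
    {w : ℝ} (hw : 0 < w) (y : EuclideanSpace ℝ (Fin 3)) (hy : y 0 = 0)
    (m : ℕ) (k : Fin m → ℕ) (A : (a : Fin m) → Fin (k a) → EuclideanSpace ℝ (Fin 3)) (c : Fin m → ℝ)
    (m' : ℕ) (k' : Fin m' → ℕ) (B : (b : Fin m') → Fin (k' b) → EuclideanSpace ℝ (Fin 3)) (d : Fin m' → ℝ)
    (hA : ∀ a i, 0 < A a i 0) (hB : ∀ b j, 0 < B b j 0) :
    (∑ a, ∑ b, c a * d b * S (k a + 1 + k' b)
        (Fin.append (Fin.append (fun i => axisReflection 0 (A a i + w • EuclideanSpace.single 0 1)) ![y])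
          (fun j => B b j + w • EuclideanSpace.single 0 1))) ^ 2
      ≤ (w ^ (-Δ)) ^ 2 *
        (C₁ ^ 2 *
          (∑ a, ∑ a', c a * c a' * S (k a + k a') (Fin.append (fun i => axisReflection 0 (A a i)) (A a'))) *
          (∑ b, ∑ b', d b * d b' * S (k' b + k' b') (Fin.append (fun j => axisReflection 0 (B b j)) (B b')))) := by
  rw [sandwich_scale hsc hw, mul_pow]
  refine mul_le_mul_of_nonneg_left ?_ (sq_nonneg _)
  have key := hunit (w⁻¹ • y) (by simp [hy]) m k (fun a i => w⁻¹ • A a i)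
    (fun a => c a * w ^ (-(k a : ℝ) * Δ)) m' k' (fun b j => w⁻¹ • B b j)
    (fun b => d b * w ^ (-(k' b : ℝ) * Δ))
    (fun a i => by rw [PiLp.smul_apply, smul_eq_mul]; exact mul_pos (inv_pos.2 hw) (hA a i))
    (fun b j => by rw [PiLp.smul_apply, smul_eq_mul]; exact mul_pos (inv_pos.2 hw) (hB b j))
  rw [osNorm_scale hsc hw m k A c, osNorm_scale hsc hw m' k' B d] at key
  exact key

/-! ## Reflection positivity and the contraction property of the transfer semigroup of the frame `e₀` -/

/-- The mirror reflection of the frame `e₀` is the coordinate reflection `θ₀`. -/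
theorem reflection_span_single_zero (x : EuclideanSpace ℝ (Fin 3)) :
    (ℝ ∙ (EuclideanSpace.single 0 1 : EuclideanSpace ℝ (Fin 3)))ᗮ.reflection x = axisReflection 0 x :=
  refl_single_zero x

/-- **The OS norm (squared) of a cluster combination is non-negative** (reflection positivity in `e₀^⊥`). -/
theorem osNorm_nonneg {Δ : ℝ} {S : CorrFamily 3} (hL : LimitStructure Δ S)
    (m : ℕ) (k : Fin m → ℕ) (A : (a : Fin m) → Fin (k a) → EuclideanSpace ℝ (Fin 3)) (c : Fin m → ℝ)
    (hA : ∀ a i, 0 < A a i 0) :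
    0 ≤ ∑ a, ∑ a', c a * c a' * S (k a + k a') (Fin.append (fun i => axisReflection 0 (A a i)) (A a')) := by
  have h := hL.2 (EuclideanSpace.single 0 1) single_zero_mem m k A c
    (fun a i => by rw [inner_single_zero_right]; exact hA a i)
  simpa only [refl_single_zero] using h

/-- The Gram formula for real combinations of kernel vectors of the mirror `e₀^⊥`. -/
theorem norm_sum_smul_gen_sq {S : CorrFamily 3}
    (h : MirrorOSData S (EuclideanSpace.single 0 1 : EuclideanSpace ℝ (Fin 3))) {m : ℕ} (c : Fin m → ℝ)
    (Y : Fin m → HalfSpaceCluster 3 (EuclideanSpace.single 0 1 : EuclideanSpace ℝ (Fin 3))) :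
    ‖∑ a, (c a : ℂ) • h.gen (Y a)‖ ^ 2 =
      ∑ a, ∑ a', c a * c a' * mirrorKernel S (EuclideanSpace.single 0 1) (Y a) (Y a') := by
  rw [@norm_sq_eq_re_inner ℂ, sum_inner, RCLike.re_to_complex, Complex.re_sum]
  refine Finset.sum_congr rfl fun a _ => ?_
  rw [inner_sum, Complex.re_sum]
  refine Finset.sum_congr rfl fun a' _ => ?_
  rw [inner_smul_left, inner_smul_right, h.inner_gen_gen, Complex.conj_ofReal, ← Complex.ofReal_mul,
    ← Complex.ofReal_mul, Complex.ofReal_re]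
  ring

/-- **CONTRACTION.** The OS norm (squared) of a cluster combination pushed up by `t e₀`, `t ≥ 0`, is at
most the unshifted one: `‖e^{-tH} ψ‖ ≤ ‖ψ‖` for the transfer semigroup of the kernel-level OS space of
the mirror `e₀^⊥` (`MirrorOSData.transfer`, contraction by the OS iteration against bounded kernel
entries), with `ψ = Σ_a c_a δ_{A^a}` and `e^{-tH} δ_{A^a} = δ_{A^a + t e₀}`. -/
theorem osNorm_shift_le {Δ : ℝ} {S : CorrFamily 3} (hL : LimitStructure Δ S) {t : ℝ} (ht : 0 ≤ t)
    (m : ℕ) (k : Fin m → ℕ) (A : (a : Fin m) → Fin (k a) → EuclideanSpace ℝ (Fin 3)) (c : Fin m → ℝ)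
    (hA : ∀ a i, 0 < A a i 0) :
    (∑ a, ∑ a', c a * c a' * S (k a + k a')
        (Fin.append (fun i => axisReflection 0 (A a i + t • EuclideanSpace.single 0 1))
          (fun i => A a' i + t • EuclideanSpace.single 0 1))) ≤
      ∑ a, ∑ a', c a * c a' * S (k a + k a') (Fin.append (fun i => axisReflection 0 (A a i)) (A a')) := by
  have h : MirrorOSData S (EuclideanSpace.single 0 1 : EuclideanSpace ℝ (Fin 3)) :=
    mirrorOSData_latticeNormal hL single_zero_mem
  have hn' : ⟪(0 : EuclideanSpace ℝ (Fin 3)), (EuclideanSpace.single 0 1 : EuclideanSpace ℝ (Fin 3))⟫_ℝ = 0 :=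
    inner_zero_left _
  -- the clusters and their combination
  set X : Fin m → HalfSpaceCluster 3 (EuclideanSpace.single 0 1 : EuclideanSpace ℝ (Fin 3)) :=
    fun a => ⟨k a, A a, fun i => by rw [inner_single_zero_right]; exact hA a i⟩ with hX
  set ψ : h.Space := ∑ a, (c a : ℂ) • h.gen (X a) with hψ
  have hP := h.isEnergyMomentumPair 0 hn'
  -- `e^{-tH}` on kernel vectors
  have hgen : ∀ x : HalfSpaceCluster 3 (EuclideanSpace.single 0 1 : EuclideanSpace ℝ (Fin 3)),
      h.transfer 0 hn' t (h.gen x) = h.gen (HalfSpaceCluster.shift 0 hn' t 0 x) := by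
    intro x
    have h1 := h.transfer_lc 0 hn' t (Finsupp.single x 1)
    simpa [Finsupp.mapDomain_single] using h1
  have hTψ : h.transfer 0 hn' t ψ = ∑ a, (c a : ℂ) • h.gen (HalfSpaceCluster.shift 0 hn' t 0 (X a)) := by
    simp only [hψ, map_sum, map_smul, hgen]
  -- contraction
  have hle : ‖h.transfer 0 hn' t ψ‖ ≤ ‖ψ‖ := by
    refine ((h.transfer 0 hn' t).le_opNorm ψ).trans ?_
    have h1 := hP.norm_transfer_le ht
    calc ‖h.transfer 0 hn' t‖ * ‖ψ‖ ≤ 1 * ‖ψ‖ := mul_le_mul_of_nonneg_right h1 (norm_nonneg _)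
      _ = ‖ψ‖ := one_mul _
  have h2 : ‖h.transfer 0 hn' t ψ‖ ^ 2 ≤ ‖ψ‖ ^ 2 := pow_le_pow_left₀ (norm_nonneg _) hle 2
  rw [hTψ, hψ, norm_sum_smul_gen_sq h c, norm_sum_smul_gen_sq h c] at h2
  -- the kernel entries
  have hvec : (0 : ℝ) • (0 : EuclideanSpace ℝ (Fin 3)) + max t 0 • EuclideanSpace.single 0 1 =
      t • EuclideanSpace.single 0 1 := by
    rw [smul_zero, zero_add, max_eq_left ht]
  have hK : ∀ a a', mirrorKernel S (EuclideanSpace.single 0 1) (HalfSpaceCluster.shift 0 hn' t 0 (X a))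
      (HalfSpaceCluster.shift 0 hn' t 0 (X a')) =
      S (k a + k a') (Fin.append (fun i => axisReflection 0 (A a i + t • EuclideanSpace.single 0 1))
        (fun i => A a' i + t • EuclideanSpace.single 0 1)) := by
    intro a a'
    show S (k a + k a') (Fin.append
      (fun i => (ℝ ∙ (EuclideanSpace.single 0 1 : EuclideanSpace ℝ (Fin 3)))ᗮ.reflection
        (A a i + ((0 : ℝ) • (0 : EuclideanSpace ℝ (Fin 3)) + max t 0 • EuclideanSpace.single 0 1)))
      (fun i => A a' i + ((0 : ℝ) • (0 : EuclideanSpace ℝ (Fin 3)) + max t 0 • EuclideanSpace.single 0 1))) = _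
    simp only [hvec, reflection_span_single_zero]
  have hK0 : ∀ a a', mirrorKernel S (EuclideanSpace.single 0 1) (X a) (X a') =
      S (k a + k a') (Fin.append (fun i => axisReflection 0 (A a i)) (A a')) := by
    intro a a'
    show S (k a + k a') (Fin.append
      (fun i => (ℝ ∙ (EuclideanSpace.single 0 1 : EuclideanSpace ℝ (Fin 3)))ᗮ.reflection (A a i)) (A a')) = _
    simp only [reflection_span_single_zero]
  simpa only [hK, hK0] using h2

/-! ## Assembly -/

/-- The arithmetic of the final chain of inequalities. -/
theorem final_chain {L W C K NA NB NA' NB' : ℝ} (hkey : L ≤ W * (C * NA' * NB')) (hW : 0 ≤ W) (hC : 0 ≤ C)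
    (hA : NA' ≤ NA) (hB : NB' ≤ NB) (hB0 : 0 ≤ NB') (hA1 : 0 ≤ NA) (hWC : W * C ≤ K) :
    L ≤ K * NA * NB := by
  have h1 : NA' * NB' ≤ NA * NB := mul_le_mul hA hB hB0 hA1
  have h2 : 0 ≤ NA * NB := mul_nonneg hA1 (hB0.trans hB)
  calc L ≤ W * (C * NA' * NB') := hkey
    _ = (W * C) * (NA' * NB') := by ring
    _ ≤ (W * C) * (NA * NB) := mul_le_mul_of_nonneg_left h1 (mul_nonneg hW hC)
    _ ≤ K * (NA * NB) := mul_le_mul_of_nonneg_right hWC h2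
    _ = K * NA * NB := by ring

/-- **S3'a · `stub_axisSigmaBound_of_unit` (M, provable now).**  The unit bound implies the frame-`e₀` two-sided sigma bound for
all `u, v > 0` with `C = 2 C₁`: (i) the `(u,v)` sandwich form on clusters `A, B` IS the `(m,m)` form, `m = min u v`, on the shifted
clusters `A + (u-m)e₀`, `B + (v-m)e₀` (same configurations); (ii) by scale covariance (`IsScaleCovariant Δ S`, dilation by `m⁻¹`,
coefficients `c_a m^{-k_a Δ}`, `d_b m^{-k'_b Δ}`) the `(m,m)` form is `m^{-Δ}` times a unit form and the OS norms are invariant;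
(iii) the OS norm of a shifted cluster combination is at most the unshifted one (the transfer semigroup of the frame `e₀` is a
contraction on cluster combinations: reflection positivity `MirrorRP e₀` + bounded entries `PairDominated` + the OS iteration, tree
`PointwiseOSReconstruction`/`MirrorClusterOSSpace`); (iv) `m^{-Δ} ≤ u^{-Δ} + v^{-Δ}`.  (Here with the constant `C = |C₁|`.) -/
theorem stub_axisSigmaBound_of_unit :
    ∀ (Δ : ℝ) (S : CorrFamily 3), LimitStructure Δ S →
      (∃ C₁ : ℝ, ∀ y : EuclideanSpace ℝ (Fin 3), y 0 = 0 →
        ∀ (m : ℕ) (k : Fin m → ℕ) (A : (a : Fin m) → Fin (k a) → EuclideanSpace ℝ (Fin 3)) (c : Fin m → ℝ)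
          (m' : ℕ) (k' : Fin m' → ℕ) (B : (b : Fin m') → Fin (k' b) → EuclideanSpace ℝ (Fin 3))
          (d : Fin m' → ℝ),
          (∀ a i, 0 < A a i 0) → (∀ b j, 0 < B b j 0) →
          (∑ a, ∑ b, c a * d b * S (k a + 1 + k' b)
              (Fin.append (Fin.append (fun i => axisReflection 0 (A a i + EuclideanSpace.single 0 1)) ![y])
                (fun j => B b j + EuclideanSpace.single 0 1))) ^ 2
            ≤ C₁ ^ 2 *
              (∑ a, ∑ a', c a * c a' * S (k a + k a')
                (Fin.append (fun i => axisReflection 0 (A a i)) (A a'))) *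
              (∑ b, ∑ b', d b * d b' * S (k' b + k' b')
                (Fin.append (fun j => axisReflection 0 (B b j)) (B b')))) →
      ∃ C : ℝ, ∀ u v : ℝ, 0 < u → 0 < v → ∀ y : EuclideanSpace ℝ (Fin 3), y 0 = 0 →
        ∀ (m : ℕ) (k : Fin m → ℕ) (A : (a : Fin m) → Fin (k a) → EuclideanSpace ℝ (Fin 3)) (c : Fin m → ℝ)
          (m' : ℕ) (k' : Fin m' → ℕ) (B : (b : Fin m') → Fin (k' b) → EuclideanSpace ℝ (Fin 3))
          (d : Fin m' → ℝ),
          (∀ a i, 0 < A a i 0) → (∀ b j, 0 < B b j 0) →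
          (∑ a, ∑ b, c a * d b * S (k a + 1 + k' b)
              (Fin.append (Fin.append (fun i => axisReflection 0 (A a i + u • EuclideanSpace.single 0 1)) ![y])
                (fun j => B b j + v • EuclideanSpace.single 0 1))) ^ 2
            ≤ (C * (u ^ (-Δ) + v ^ (-Δ))) ^ 2 *
              (∑ a, ∑ a', c a * c a' * S (k a + k a')
                (Fin.append (fun i => axisReflection 0 (A a i)) (A a'))) *
              (∑ b, ∑ b', d b * d b' * S (k' b + k' b')
                (Fin.append (fun j => axisReflection 0 (B b j)) (B b'))) := by
  intro Δ S hL hunit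
  obtain ⟨C₁, hC₁⟩ := hunit
  have hsc : IsScaleCovariant Δ S := hL.1.2.2.1
  refine ⟨|C₁|, fun u v hu hv y hy m k A c m' k' B d hA hB => ?_⟩
  -- the common height `w = min u v`
  obtain ⟨w, hw, hwu, hwv, hmin⟩ :
      ∃ w : ℝ, 0 < w ∧ w ≤ u ∧ w ≤ v ∧ w ^ (-Δ) ≤ u ^ (-Δ) + v ^ (-Δ) := by
    rcases le_total u v with h | h
    · exact ⟨u, hu, le_rfl, h, le_add_of_nonneg_right (Real.rpow_nonneg hv.le _)⟩
    · exact ⟨v, hv, h, le_rfl, le_add_of_nonneg_left (Real.rpow_nonneg hu.le _)⟩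
  -- (i) SHIFT
  have hu' : ∀ x : EuclideanSpace ℝ (Fin 3), x + u • EuclideanSpace.single 0 1 =
      x + (u - w) • EuclideanSpace.single 0 1 + w • EuclideanSpace.single 0 1 := fun x => by
    rw [add_assoc, ← add_smul, sub_add_cancel]
  have hv' : ∀ x : EuclideanSpace ℝ (Fin 3), x + v • EuclideanSpace.single 0 1 =
      x + (v - w) • EuclideanSpace.single 0 1 + w • EuclideanSpace.single 0 1 := fun x => by
    rw [add_assoc, ← add_smul, sub_add_cancel]
  have hA' : ∀ a i, 0 < (A a i + (u - w) • (EuclideanSpace.single 0 1 : EuclideanSpace ℝ (Fin 3))) 0 :=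
    fun a i => by
    have e : (A a i + (u - w) • (EuclideanSpace.single 0 1 : EuclideanSpace ℝ (Fin 3))) 0 = A a i 0 + (u - w) := by
      simp
    rw [e]
    linarith [hA a i]
  have hB' : ∀ b j, 0 < (B b j + (v - w) • (EuclideanSpace.single 0 1 : EuclideanSpace ℝ (Fin 3))) 0 :=
    fun b j => by
    have e : (B b j + (v - w) • (EuclideanSpace.single 0 1 : EuclideanSpace ℝ (Fin 3))) 0 = B b j 0 + (v - w) := by
      simp
    rw [e]
    linarith [hB b j]
  simp only [hu', hv']
  -- (ii) SCALE on the shifted clusters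
  have key := scale_step hsc hC₁ hw y hy m k (fun a i => A a i + (u - w) • EuclideanSpace.single 0 1) c m' k'
    (fun b j => B b j + (v - w) • EuclideanSpace.single 0 1) d hA' hB'
  -- (iii) CONTRACTION and (iv) the constants
  have hNA := osNorm_shift_le hL (sub_nonneg.2 hwu) m k A c hA
  have hNB := osNorm_shift_le hL (sub_nonneg.2 hwv) m' k' B d hB
  have hNB0 := osNorm_nonneg hL m' k' (fun b j => B b j + (v - w) • EuclideanSpace.single 0 1) d hB'
  have hNA1 := osNorm_nonneg hL m k A c hA
  have h0 : 0 ≤ w ^ (-Δ) := Real.rpow_nonneg hw.le _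
  have hWC : (w ^ (-Δ)) ^ 2 * C₁ ^ 2 ≤ (|C₁| * (u ^ (-Δ) + v ^ (-Δ))) ^ 2 := by
    calc (w ^ (-Δ)) ^ 2 * C₁ ^ 2 = (w ^ (-Δ) * |C₁|) ^ 2 := by rw [mul_pow, sq_abs]
      _ ≤ ((u ^ (-Δ) + v ^ (-Δ)) * |C₁|) ^ 2 :=
          pow_le_pow_left₀ (mul_nonneg h0 (abs_nonneg _)) (mul_le_mul_of_nonneg_right hmin (abs_nonneg _)) 2
      _ = (|C₁| * (u ^ (-Δ) + v ^ (-Δ))) ^ 2 := by ring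
  exact final_chain key (sq_nonneg _) (sq_nonneg _) hNA hNB hNB0 hNA1 hWC

end Summit.CriticalPhenomena.Ising3DConformalLimit.Cruxes.LimitRotationInvariant.QuarterTurnLiouville

end
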